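import Summits.Ventures.CertifiedManyBodySolver.Theorems.M3x2EdgeSplitSymReplayMoves

/-!
# SymReplay checker — NORMAL WORDS (S7, part 1 of 2): the normal-orderer outputs normal words; ladder-word actions on the occupation basis

Team lb-sym (cell hub-lb), hub-lb-sym-eng-4 g1.  Groundwork for S7 `NormalWordsIndependent` of
`Cruxes/LowerEdge_ge_m83o100/Lines/symreplay.lean` (hub-lb-sym-plan-1): (i) a word is *normal* when every letter
constrains all later letters as the CAR normal-orderer `insL`/`nfWord` (T1 `…Theorems.M3x2EdgeSplitSymReplaySyntax`)
arranges them — creators in strictly increasing mode order, then annihilators in strictly increasing mode order; every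
word produced by `nfWord` is normal (`nfWord_normal`), so the S7 hypothesis `nfWord w = [(1, w)]` yields normality of `w`
without a fixed-point analysis; `Letter.modeLt` is a strict total order on modes (lexicographic on `(x 0, x 1, s)`);
(ii) in the tree's Jordan–Wigner model (`HubbardWave0.annihilation/creation` on `Fock ι = Finset ι → ℂ`) a product of
creators at distinct orbitals `ps` times a product of annihilators at distinct orbitals `qs` maps the basis vector `|A⟩`
to a NONZERO multiple of `|ps ∪ (A ∖ qs)⟩` when `qs ⊆ A` and `ps ∩ (A ∖ qs) = ∅`, and to `0` otherwise (signed partial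
permutations; `creAnn_mulVec_single`, entry forms `creAnn_apply_ne_zero`, `creAnn_apply_self_ne_zero`).
No summit statement is proved here; nothing here predicts superconductivity.
-/

noncomputable section

namespace Summit.Ventures.CertifiedManyBodySolver.Theorems.SymReplay

open Matrix Finset
open Literature.MathematicalPhysics.QuantumLattice
open Literature.MathematicalPhysics.QuantumLattice.HubbardWave0
open Literature.Probability.LatticeModels (Site)

/-! ## The mode order -/

/-- Unfolding of `Letter.modeLt` into integer / natural-number comparisons. -/
theorem modeLt_iff (a b : Letter) :
    a.modeLt b = true ↔ (a.x 0 < b.x 0 ∨ (a.x 0 = b.x 0 ∧ a.x 1 < b.x 1)) ∨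
      ((a.x 0 = b.x 0 ∧ a.x 1 = b.x 1) ∧ a.s.val < b.s.val) := by
  simp [Letter.modeLt, siteLt, siteEq, Bool.or_eq_true, Bool.and_eq_true, decide_eq_true_eq, beq_iff_eq]

/-- Unfolding of `Letter.modeEq`. -/
theorem modeEq_iff' (a b : Letter) :
    a.modeEq b = true ↔ (a.x 0 = b.x 0 ∧ a.x 1 = b.x 1) ∧ a.s = b.s := by
  simp [Letter.modeEq, siteEq, Bool.and_eq_true, beq_iff_eq]

/-- `modeLt` is transitive. -/
theorem modeLt_trans {a b c : Letter} (hab : a.modeLt b = true) (hbc : b.modeLt c = true) :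
    a.modeLt c = true := by
  rw [modeLt_iff] at hab hbc ⊢
  omega

/-- `modeLt` is irreflexive against `modeEq`: equal modes are not `modeLt`. -/
theorem modeLt_irrefl_of_modeEq {a b : Letter} (h : a.modeEq b = true) : a.modeLt b = false := by
  rw [modeEq_iff'] at h
  cases hlt : a.modeLt b
  · rfl
  · rw [modeLt_iff] at hlt
    have hs : a.s.val = b.s.val := by rw [h.2]
    omega

/-- Totality: two letters of different modes compare one way or the other. -/
theorem modeLt_total {a b : Letter} (hne : a.modeEq b = false) (hlt : a.modeLt b = false) :
    b.modeLt a = true := by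
  rw [modeLt_iff]
  have hne' : ¬ ((a.x 0 = b.x 0 ∧ a.x 1 = b.x 1) ∧ a.s = b.s) := by
    rw [← modeEq_iff', hne]; exact Bool.false_ne_true
  have hlt' : ¬ ((a.x 0 < b.x 0 ∨ (a.x 0 = b.x 0 ∧ a.x 1 < b.x 1)) ∨
      ((a.x 0 = b.x 0 ∧ a.x 1 = b.x 1) ∧ a.s.val < b.s.val)) := by
    rw [← modeLt_iff, hlt]; exact Bool.false_ne_true
  have hs : a.s = b.s ↔ a.s.val = b.s.val := Fin.ext_iff
  omega

/-! ## Normal words -/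

/-- The constraint a letter of a normal word imposes on every LATER letter: after a creator, creators have
strictly larger mode; after an annihilator come only annihilators of strictly larger mode. -/
def NRel (a b : Letter) : Prop :=
  (a.dag = true → b.dag = true → a.modeLt b = true) ∧ (a.dag = false → b.dag = false ∧ a.modeLt b = true)

/-- **Normal word**: creators in strictly increasing mode order, then annihilators in strictly increasing mode
order (the shape produced by `insL` / `nfWord`). -/
def Normal (w : Word) : Prop := w.Pairwise NRel

/-- The empty word is normal. -/
theorem normal_nil : Normal [] := List.Pairwise.nil

/-- Unfolding of normality at a cons. -/
theorem normal_cons {a : Letter} {v : Word} :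
    Normal (a :: v) ↔ (∀ b ∈ v, NRel a b) ∧ Normal v := List.pairwise_cons

/-- The tail of a normal word is normal. -/
theorem Normal.tail {a : Letter} {v : Word} (h : Normal (a :: v)) : Normal v := (normal_cons.1 h).2

/-- The head of a normal word constrains every later letter. -/
theorem Normal.rel {a : Letter} {v : Word} (h : Normal (a :: v)) : ∀ b ∈ v, NRel a b := (normal_cons.1 h).1

/-- After an annihilator, every letter of a normal word is an annihilator. -/
theorem Normal.dag_false_of_head {a : Letter} {v : Word} (h : Normal (a :: v)) (ha : a.dag = false) :
    ∀ b ∈ v, b.dag = false := fun b hb => ((h.rel b hb).2 ha).1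

/-! ## `insL` and `nfWord` produce normal words -/

/-- `consNeg m` prefixes `m`: normality of the results from normality of the tails plus the head constraint. -/
theorem consNeg_normal (m : Letter) (p : QPoly) (hp : ∀ t ∈ p, Normal t.2 ∧ ∀ b ∈ t.2, NRel m b) :
    ∀ t ∈ consNeg m p, Normal t.2 := by
  intro t ht
  simp only [consNeg, List.mem_map] at ht
  obtain ⟨t0, ht0, rfl⟩ := ht
  exact normal_cons.2 ⟨(hp t0 ht0).2, (hp t0 ht0).1⟩

/-- **`insL` preserves normality.** -/
theorem insL_normal (ℓ : Letter) : ∀ (u : Word), Normal u → ∀ t ∈ insL ℓ u, Normal t.2 := by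
  intro u
  induction u with
  | nil =>
    intro _ t ht
    simp only [insL, List.mem_singleton] at ht
    subst ht
    exact normal_cons.2 ⟨fun b hb => by simp at hb, normal_nil⟩
  | cons m rest ih =>
    intro hN t ht
    have hrest : Normal rest := hN.tail
    have hm : ∀ b ∈ rest, NRel m b := hN.rel
    -- the `consNeg m (insL ℓ rest)` outputs are normal as soon as `NRel m ℓ` holds
    have hcn : NRel m ℓ → ∀ t ∈ consNeg m (insL ℓ rest), Normal t.2 := by
      intro hmℓ
      refine consNeg_normal m _ (fun t0 ht0 => ⟨ih hrest t0 ht0, fun b hb => ?_⟩)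
      rcases List.mem_cons.1 (insL_letters ℓ rest t0 ht0 hb) with rfl | hb'
      · exact hmℓ
      · exact hm b hb'
    cases hd : ℓ.dag <;> cases hmd : m.dag <;>
      simp only [insL, hd, hmd, Bool.false_eq_true, if_false, if_true] at ht
    · -- ℓ annihilator, m annihilator
      split_ifs at ht with heq hlt
      · simp at ht
      · -- ℓ < m : ℓ :: m :: rest
        simp only [List.mem_singleton] at ht
        subst ht
        refine normal_cons.2 ⟨fun b hb => ⟨fun h => by simp [hd] at h, fun _ => ?_⟩, hN⟩
        rcases List.mem_cons.1 hb with rfl | hb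
        · exact ⟨hmd, hlt⟩
        · have hb' := (hm b hb).2 hmd
          exact ⟨hb'.1, modeLt_trans hlt hb'.2⟩
      · -- m < ℓ : consNeg
        have hml : m.modeLt ℓ = true := modeLt_total (by simpa using heq) (by simpa using hlt)
        exact hcn ⟨fun h => by simp [hmd] at h, fun _ => ⟨hd, hml⟩⟩ t ht
    · -- ℓ annihilator, m creator : (if modeEq then [(1, rest)] else []) ++ consNeg …
      rw [List.mem_append] at ht
      rcases ht with ht | ht
      · split_ifs at ht
        · simp only [List.mem_singleton] at ht
          subst ht
          exact hrest
        · simp at ht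
      · exact hcn ⟨fun _ h => by simp [hd] at h, fun h => by simp [hmd] at h⟩ t ht
    · -- ℓ creator, m annihilator : ℓ :: m :: rest
      simp only [List.mem_singleton] at ht
      subst ht
      refine normal_cons.2 ⟨fun b hb => ⟨fun _ hb' => ?_, fun h => by simp [hd] at h⟩, hN⟩
      rcases List.mem_cons.1 hb with rfl | hb
      · simp [hmd] at hb'
      · have := hN.dag_false_of_head hmd b hb
        simp [this] at hb'
    · -- ℓ creator, m creator
      split_ifs at ht with heq hlt
      · simp at ht
      · simp only [List.mem_singleton] at ht
        subst ht
        refine normal_cons.2 ⟨fun b hb => ⟨fun _ hb' => ?_, fun h => by simp [hd] at h⟩, hN⟩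
        rcases List.mem_cons.1 hb with rfl | hb
        · exact hlt
        · exact modeLt_trans hlt ((hm b hb).1 hmd hb')
      · have hml : m.modeLt ℓ = true := modeLt_total (by simpa using heq) (by simpa using hlt)
        exact hcn ⟨fun _ _ => hml, fun h => by simp [hmd] at h⟩ t ht

/-- **Every word produced by the normal-orderer is normal.** -/
theorem nfWord_normal (w : Word) : ∀ t ∈ nfWord w, Normal t.2 := by
  induction w with
  | nil => intro t ht; simp only [nfWord, List.mem_singleton] at ht; subst ht; exact normal_nil
  | cons ℓ w ih =>
    intro t ht
    simp only [nfWord, List.mem_flatMap, List.mem_map] at ht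
    obtain ⟨t0, ht0, t1, ht1, rfl⟩ := ht
    exact insL_normal ℓ t0.2 (ih t0 ht0) t1 ht1

/-- A word fixed by the normal-orderer (`nfWord w = [(1, w)]`) is normal. -/
theorem normal_of_nfWord_eq (w : Word) (h : nfWord w = [(1, w)]) : Normal w := by
  have := nfWord_normal w (1, w) (by rw [h]; exact List.mem_singleton.2 rfl)
  exact this


/-! ## Normal words split into a creator block and an annihilator block -/

/-- The strict mode order az a relation. -/
def MLt (a b : Letter) : Prop := a.modeLt b = true

/-- A normal word splits as a `modeLt`-sorted creator block followed by a `modeLt`-sorted annihilator block. -/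
theorem normal_split (w : Word) (hw : Normal w) :
    ∃ cs az : Word, w = cs ++ az ∧ (∀ ℓ ∈ cs, ℓ.dag = true) ∧ (∀ ℓ ∈ az, ℓ.dag = false) ∧
      cs.Pairwise MLt ∧ az.Pairwise MLt := by
  induction w with
  | nil => exact ⟨[], [], rfl, by simp, by simp, List.Pairwise.nil, List.Pairwise.nil⟩
  | cons a v ih =>
    obtain ⟨cs, az, hv, hc, han, hpc, hpa⟩ := ih hw.tail
    cases hd : a.dag
    · -- annihilator head: everything after is an annihilator, so `cs = []`
      have hall : ∀ b ∈ v, b.dag = false := hw.dag_false_of_head hd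
      have hcs : cs = [] := by
        cases cs with
        | nil => rfl
        | cons c cs' =>
          exfalso
          have h1 := hc c List.mem_cons_self
          have h2 := hall c (by rw [hv]; exact List.mem_append_left _ List.mem_cons_self)
          rw [h1] at h2; exact Bool.noConfusion h2
      subst hcs
      have haz : v = az := by simpa using hv
      refine ⟨[], a :: az, by rw [haz]; rfl, by simp, ?_, List.Pairwise.nil, ?_⟩
      · intro ℓ hℓ
        rcases List.mem_cons.1 hℓ with rfl | h
        · exact hd
        · exact han ℓ h
      · exact List.pairwise_cons.2 ⟨fun b hb => ((hw.rel b (by rw [haz]; exact hb)).2 hd).2, hpa⟩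
    · -- creator head
      subst hv
      refine ⟨a :: cs, az, rfl, ?_, han, ?_, hpa⟩
      · intro ℓ hℓ
        rcases List.mem_cons.1 hℓ with rfl | h
        · exact hd
        · exact hc ℓ h
      · exact List.pairwise_cons.2 ⟨fun b hb => (hw.rel b (List.mem_append_left _ hb)).1 hd (hc b hb), hpc⟩


section FockAction

variable {ι : Type*} [LinearOrder ι] [Fintype ι]

/-- A product of annihilators at pairwise distinct orbitals `qs` maps `|A⟩` to a NONZERO multiple of `|A ∖ qs⟩`
when every `q ∈ qs` is occupied in `A`, and to `0` otherwise. -/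
theorem annList_mulVec_single (qs : List ι) (hq : qs.Nodup) (A : Finset ι) :
    ∃ u : ℂ, u ≠ 0 ∧ (qs.map annihilation).prod *ᵥ Pi.single A (1 : ℂ) =
      if ∀ q ∈ qs, q ∈ A then u • Pi.single (A \ qs.toFinset) 1 else 0 := by
  induction qs with
  | nil =>
    refine ⟨1, one_ne_zero, ?_⟩
    rw [List.map_nil, List.prod_nil, Matrix.one_mulVec, if_pos (fun q hq => absurd hq List.not_mem_nil),
      List.toFinset_nil, Finset.sdiff_empty, one_smul]
  | cons q qs ih =>
    obtain ⟨u, hu, h⟩ := ih (List.nodup_cons.1 hq).2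
    have hqn : q ∉ qs := (List.nodup_cons.1 hq).1
    rw [List.map_cons, List.prod_cons, ← Matrix.mulVec_mulVec, h]
    by_cases hall : ∀ q' ∈ qs, q' ∈ A
    · rw [if_pos hall, Matrix.mulVec_smul, annihilation_mulVec_single]
      by_cases hqA : q ∈ A
      · have hmem : q ∈ A \ qs.toFinset := Finset.mem_sdiff.2 ⟨hqA, by simpa using hqn⟩
        refine ⟨u * jwSign q (A \ qs.toFinset), mul_ne_zero hu (jwSign_ne_zero _ _), ?_⟩
        have hall' : ∀ q' ∈ q :: qs, q' ∈ A := by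
          intro q' hq'
          rcases List.mem_cons.1 hq' with rfl | h'
          · exact hqA
          · exact hall q' h'
        rw [if_pos hmem, if_pos hall', smul_smul, List.toFinset_cons, Finset.sdiff_insert]
      · refine ⟨u, hu, ?_⟩
        have hnm : q ∉ A \ qs.toFinset := fun h' => hqA (Finset.mem_sdiff.1 h').1
        have hnall : ¬ ∀ q' ∈ q :: qs, q' ∈ A := fun h' => hqA (h' q List.mem_cons_self)
        rw [if_neg hnm, smul_zero, if_neg hnall]
    · refine ⟨u, hu, ?_⟩
      have hnall : ¬ ∀ q' ∈ q :: qs, q' ∈ A := fun h' => hall (fun q' hq' => h' q' (List.mem_cons_of_mem _ hq'))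
      rw [if_neg hall, Matrix.mulVec_zero, if_neg hnall]

/-- A product of creators at pairwise distinct orbitals `ps` maps `|S⟩` to a NONZERO multiple of `|ps ∪ S⟩`
when no `p ∈ ps` is occupied in `S`, and to `0` otherwise. -/
theorem creList_mulVec_single (ps : List ι) (hp : ps.Nodup) (S : Finset ι) :
    ∃ u : ℂ, u ≠ 0 ∧ (ps.map creation).prod *ᵥ Pi.single S (1 : ℂ) =
      if ∀ p ∈ ps, p ∉ S then u • Pi.single (ps.toFinset ∪ S) 1 else 0 := by
  induction ps with
  | nil =>
    refine ⟨1, one_ne_zero, ?_⟩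
    rw [List.map_nil, List.prod_nil, Matrix.one_mulVec, if_pos (fun p hp => absurd hp List.not_mem_nil),
      List.toFinset_nil, Finset.empty_union, one_smul]
  | cons p ps ih =>
    obtain ⟨u, hu, h⟩ := ih (List.nodup_cons.1 hp).2
    have hpn : p ∉ ps := (List.nodup_cons.1 hp).1
    rw [List.map_cons, List.prod_cons, ← Matrix.mulVec_mulVec, h]
    by_cases hall : ∀ p' ∈ ps, p' ∉ S
    · rw [if_pos hall, Matrix.mulVec_smul, FermionOperatorsProofs.creation_mulVec_single]
      by_cases hpS : p ∈ S
      · refine ⟨u, hu, ?_⟩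
        have hmem : p ∈ ps.toFinset ∪ S := Finset.mem_union_right _ hpS
        have hnall : ¬ ∀ p' ∈ p :: ps, p' ∉ S := fun h' => h' p List.mem_cons_self hpS
        rw [if_pos hmem, smul_zero, if_neg hnall]
      · have hnm : p ∉ ps.toFinset ∪ S := by
          intro h'
          rcases Finset.mem_union.1 h' with h' | h'
          · exact hpn (by simpa using h')
          · exact hpS h'
        refine ⟨u * jwSign p (ps.toFinset ∪ S), mul_ne_zero hu (jwSign_ne_zero _ _), ?_⟩
        have hall' : ∀ p' ∈ p :: ps, p' ∉ S := by
          intro p' hp'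
          rcases List.mem_cons.1 hp' with rfl | h'
          · exact hpS
          · exact hall p' h'
        rw [if_neg hnm, if_pos hall', smul_smul, List.toFinset_cons, Finset.insert_union]
    · refine ⟨u, hu, ?_⟩
      have hnall : ¬ ∀ p' ∈ p :: ps, p' ∉ S := fun h' => hall (fun p' hp' => h' p' (List.mem_cons_of_mem _ hp'))
      rw [if_neg hall, Matrix.mulVec_zero, if_neg hnall]

/-- **Creators then annihilators** (the shape of a normal word): `(Π c†_{ps}) (Π c_{qs}) |A⟩` is a NONZERO multiple of
`|ps ∪ (A ∖ qs)⟩` when `qs ⊆ A` and `ps ∩ (A ∖ qs) = ∅`, and `0` otherwise. -/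
theorem creAnn_mulVec_single (ps qs : List ι) (hp : ps.Nodup) (hq : qs.Nodup) (A : Finset ι) :
    ∃ u : ℂ, u ≠ 0 ∧ ((ps.map creation).prod * (qs.map annihilation).prod) *ᵥ Pi.single A (1 : ℂ) =
      if (∀ q ∈ qs, q ∈ A) ∧ (∀ p ∈ ps, p ∉ A \ qs.toFinset)
      then u • Pi.single (ps.toFinset ∪ (A \ qs.toFinset)) 1 else 0 := by
  obtain ⟨u, hu, hA⟩ := annList_mulVec_single qs hq A
  obtain ⟨u', hu', hC⟩ := creList_mulVec_single ps hp (A \ qs.toFinset)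
  refine ⟨u * u', mul_ne_zero hu hu', ?_⟩
  rw [← Matrix.mulVec_mulVec, hA]
  by_cases h1 : ∀ q ∈ qs, q ∈ A
  · rw [if_pos h1, Matrix.mulVec_smul, hC]
    by_cases h2 : ∀ p ∈ ps, p ∉ A \ qs.toFinset
    · rw [if_pos h2, if_pos ⟨h1, h2⟩, smul_smul]
    · rw [if_neg h2, smul_zero, if_neg (fun h => h2 h.2)]
  · rw [if_neg h1, Matrix.mulVec_zero, if_neg (fun h => h1 h.1)]

/-- Matrix ENTRY form: `⟨B| (Π c†_{ps}) (Π c_{qs}) |A⟩ ≠ 0` forces the occupation pattern. -/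
theorem creAnn_apply_ne_zero (ps qs : List ι) (hp : ps.Nodup) (hq : qs.Nodup) (A B : Finset ι)
    (h : ((ps.map creation).prod * (qs.map annihilation).prod) B A ≠ 0) :
    (∀ q ∈ qs, q ∈ A) ∧ (∀ p ∈ ps, p ∉ A \ qs.toFinset) ∧ B = ps.toFinset ∪ (A \ qs.toFinset) := by
  obtain ⟨u, hu, hM⟩ := creAnn_mulVec_single ps qs hp hq A
  have hcol : ((ps.map creation).prod * (qs.map annihilation).prod) B A =
      (((ps.map creation).prod * (qs.map annihilation).prod) *ᵥ Pi.single A (1 : ℂ)) B := by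
    rw [Matrix.mulVec_single_one]; rfl
  rw [hcol, hM] at h
  by_cases hc : (∀ q ∈ qs, q ∈ A) ∧ (∀ p ∈ ps, p ∉ A \ qs.toFinset)
  · refine ⟨hc.1, hc.2, ?_⟩
    rw [if_pos hc, Pi.smul_apply, smul_eq_mul] at h
    by_contra hB
    exact h (by rw [Pi.single_eq_of_ne hB, mul_zero])
  · rw [if_neg hc] at h
    exact absurd rfl h

/-- … and the DIAGONAL pattern is realised: `⟨ps| (Π c†_{ps}) (Π c_{qs}) |qs⟩ ≠ 0` when `ps`, `qs` are duplicate-free. -/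
theorem creAnn_apply_self_ne_zero (ps qs : List ι) (hp : ps.Nodup) (hq : qs.Nodup) :
    ((ps.map creation).prod * (qs.map annihilation).prod) ps.toFinset qs.toFinset ≠ 0 := by
  obtain ⟨u, hu, hM⟩ := creAnn_mulVec_single ps qs hp hq qs.toFinset
  have hcol : ((ps.map creation).prod * (qs.map annihilation).prod) ps.toFinset qs.toFinset =
      (((ps.map creation).prod * (qs.map annihilation).prod) *ᵥ Pi.single qs.toFinset (1 : ℂ)) ps.toFinset := by
    rw [Matrix.mulVec_single_one]; rfl
  have hc : (∀ q ∈ qs, q ∈ qs.toFinset) ∧ (∀ p ∈ ps, p ∉ qs.toFinset \ qs.toFinset) :=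
    ⟨fun q hq' => List.mem_toFinset.2 hq', fun p _ => by simp⟩
  rw [hcol, hM, if_pos hc, Finset.sdiff_self, Finset.union_empty, Pi.smul_apply, Pi.single_eq_same, smul_eq_mul,
    mul_one]
  exact hu

end FockAction

end Summit.Ventures.CertifiedManyBodySolver.Theorems.SymReplay
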